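import Literature.Analysis.Asymptotics.LogPowerScale
import Literature.NumberTheory.Transcendental.KZSliceFubini
import HarnessLib

/-!
# Slices of integral representations and constant terms of divergent log-power expansions

An integral representation `R : KZ.IntegralRep (n + 1)` (`Literature.NumberTheory.Transcendental.KZ.IntegralRep`:
a `ℚ`-semialgebraic domain `σ ⊆ ℝⁿ⁺¹`, an absolutely integrable `ℚ`-semialgebraic integrand `f`) is
read as the *family* of its slices over the first coordinate `z 0 = s`; the slice at `s` is the
`n`-dimensional integral `I_R(s) = ∫_{x | (s, x) ∈ σ} f (s, x) dx` (`KZ.sliceValue R s`).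

For `ℚ`-semialgebraic data, `s ↦ I_R(s)` admits as `s → 0⁺` a finite expansion over monomials
`s ^ a * (log s) ^ b`, `a ∈ ℚ` (Lion–Rolin 1998; Comte–Lion–Rolin 2000, Thm. 1; Cluckers–Miller
2011, Thm. 1.3: parametric volumes / integrals of globally subanalytic families are constructible
functions; Kaiser 2017, §4 is the non-archimedean mirror over the real Puiseux series — "simple
descriptions at `∞`", Def. 4.4, with the lexicographic dominant exponent, Lemma 4.6 / Prop. 4.7).
This file does **not** state that existence theorem (it would be a named fact, to be filed only if a
prover needs it); it fixes the *predicates*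

* `KZ.HasConstantTermAt I c`: `I : ℝ → ℝ` has at `0⁺` a finite expansion
  `I s = ∑ i, w i * s ^ (a i) * (log s) ^ (b i) + c + o(1)` over **divergent** monomials
  (`a i < 0`, or `a i = 0 ∧ 0 < b i`; `a i ∈ ℚ`), with *constant term* `c`;
* `KZ.HasConstantTerm R c := KZ.HasConstantTermAt (KZ.sliceValue R) c`,

the latter VERBATIM the clause inlined in the route `ValuedFieldSpecialisation` of the summit
`KontsevichZagierPeriods` (items `CTConstruction` (CT1), `ConstantTermsArePeriods`,
`ConstantTermUnique`): `KZ.hasConstantTerm_iff` is `Iff.rfl`.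

## Main statements

* `KZ.HasConstantTermAt.unique` / `KZ.HasConstantTerm.unique` (route support item
  `ConstantTermUnique`), from `Literature.Analysis.Asymptotics.eq_zero_of_tendsto_sum_divergentMonomials`
  (divergent log-power monomials form an asymptotic scale at `0⁺`); `.of_tendsto` (no divergent
  monomials), `.congr` (only the germ at `0⁺` matters), `.add`, `.neg`, `.sub`, `.const_mul`;
  `KZ.HasConstantTerm.add_of_eventuallyEq`, `.neg`;
* `KZ.integral_sliceValue` (Fubini: `∫ s, sliceValue R s = R.value`), `KZ.integrable_sliceValue`,
  `KZ.sliceValue_add_of_integrand` / `_of_domain` (slice-wise additivity at a given `s`) and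
  `KZ.ae_sliceValue_add_of_integrand` / `_of_domain` (for a.e. `s`, from the hypotheses of the KZ
  additivity moves on the total spaces), all repackaged from `KZSliceFubini`.

**Caveat (additivity).** `HasConstantTerm` speaks about *every* small `s > 0` (`Filter.Tendsto`
along `𝓝[>] 0`); additivity of slice values for almost every `s` (which is what the KZ additivity
moves on total spaces give, by Fubini — see `KZSliceFubini`) does not by itself transfer constant
terms: `add_of_eventuallyEq` asks for additivity at all sufficiently small `s > 0`.

## References

* G. Comte, J.-M. Lion, J.-P. Rolin, *Nature log-analytique du volume des sous-analytiques*,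
  Illinois J. Math. 44 (2000), Thm. 1. [ComteLionRolin2000]
* R. Cluckers, D. J. Miller, *Stability under integration of sums of products of real globally
  subanalytic functions and their logarithms*, Duke Math. J. 156 (2011), Thm. 1.3.
* T. Kaiser, *Lebesgue measure and integration theory on non-archimedean real closed fields with
  archimedean value group*, Proc. LMS 116 (2017), §4: Def. 4.4, Lemma 4.6, Prop. 4.7. [Kaiser2017]
* M. Kontsevich, D. Zagier, *Periods* (2001), §1.2. [KontsevichZagier2001]

## Design notes

* Mathlib (searched `isLittleO_log_rpow`, `tendsto_log_mul_rpow`, `AsymptoticExpansion`,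
  `vecCons`) has the comparison lemmas for `log`/`rpow` at `0⁺` but no finite asymptotic expansion
  with a constant term; the predicate is defined here in the route's literal shape (`Fin k`-indexed
  families, exponents in `ℚ`, summand `w i * s ^ ((a i : ℚ) : ℝ) * Real.log s ^ (b i)`, filter
  `nhdsWithin 0 (Set.Ioi 0)`), on top of a function-level predicate carrying the real content.
* Uniqueness: merge the two expansions over `Fin k₁ ⊕ Fin k₂` and apply the asymptotic-scale
  lemma of `Literature/Analysis/Asymptotics/LogPowerScale.lean` (dominant-exponent induction).
-/

noncomputable section

open MeasureTheory Set Filter Topology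

namespace Literature.NumberTheory.Transcendental

namespace KZ

variable {n : ℕ}

/-! ### Constant terms of real functions at `0⁺` -/

/-- `HasConstantTermAt I c`: the real function `I` of a positive real parameter `s` has, as
`s → 0⁺`, a finite expansion over **divergent** log-power monomials with rational exponents and
*constant term* `c`:
`I s = ∑ i, w i * s ^ (a i) * (log s) ^ (b i) + c + o(1)`, `a i < 0 ∨ (a i = 0 ∧ 0 < b i)`,
`a i ∈ ℚ`, `b i ∈ ℕ`, `w i ∈ ℝ` (so `c` is the coefficient of `s⁰ (log s)⁰` in an expansion of
`I` at `0⁺` in the scale `s ^ a (log s) ^ b`, all terms tending to `0` being absorbed in the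
`o(1)`). The shape (a `Fin k`-indexed family, summand `w i * s ^ ((a i : ℚ) : ℝ) * Real.log s ^ (b i)`,
filter `nhdsWithin 0 (Set.Ioi 0)`) is verbatim the clause inlined in the route
`ValuedFieldSpecialisation` (summit `KontsevichZagierPeriods`). Such expansions exist for
parametric integrals of globally subanalytic families (Comte–Lion–Rolin 2000, Thm. 1;
Cluckers–Miller 2011, Thm. 1.3); that existence theorem is not part of this definition
(cf. Kaiser 2017, Def. 4.4: "simple descriptions" `∑_σ h_σ(x) x^{σ₁} (log x)^{σ₂}` over the
field of real Puiseux series, the non-archimedean mirror of this notion). [folklore] -/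
def HasConstantTermAt (I : ℝ → ℝ) (c : ℝ) : Prop :=
  ∃ (k : ℕ) (a : Fin k → ℚ) (b : Fin k → ℕ) (w : Fin k → ℝ), (∀ i, a i < 0 ∨ (a i = 0 ∧ 0 < b i)) ∧
    Filter.Tendsto (fun s : ℝ => I s - ∑ i, w i * s ^ ((a i : ℚ) : ℝ) * Real.log s ^ (b i))
      (nhdsWithin 0 (Set.Ioi 0)) (nhds c)

namespace HasConstantTermAt

variable {I J : ℝ → ℝ} {c d : ℝ}

/-- A finite expansion over divergent monomials indexed by any finite type gives
`HasConstantTermAt` (reindex along `Fintype.equivFin`). [folklore] -/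
theorem of_fintype {ι : Type*} [Fintype ι] (a : ι → ℚ) (b : ι → ℕ) (w : ι → ℝ)
    (hab : ∀ i, a i < 0 ∨ (a i = 0 ∧ 0 < b i))
    (h : Tendsto (fun s : ℝ => I s - ∑ i, w i * s ^ ((a i : ℚ) : ℝ) * Real.log s ^ (b i))
      (𝓝[>] 0) (𝓝 c)) :
    HasConstantTermAt I c := by
  classical
  let e := Fintype.equivFin ι
  refine ⟨Fintype.card ι, a ∘ e.symm, b ∘ e.symm, w ∘ e.symm, fun j => hab _, ?_⟩
  refine h.congr fun s => ?_
  simp only [Function.comp_apply]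
  congr 1
  exact Fintype.sum_equiv e _ _ fun i => by simp only [Equiv.symm_apply_apply]

/-- A function with a finite limit `c` at `0⁺` has constant term `c` (no divergent monomials).
[folklore] -/
theorem of_tendsto (h : Tendsto I (𝓝[>] 0) (𝓝 c)) : HasConstantTermAt I c :=
  ⟨0, ![], ![], ![], fun i => i.elim0, by simpa using h⟩

/-- The constant function `c` has constant term `c`. [folklore] -/
theorem const (c : ℝ) : HasConstantTermAt (fun _ => c) c := of_tendsto tendsto_const_nhds

/-- A divergent monomial `w * s ^ a * (log s) ^ b` (`a < 0`, or `a = 0 < b`) has constant term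
`0`. [folklore] -/
theorem monomial (w : ℝ) {a : ℚ} {b : ℕ} (hab : a < 0 ∨ (a = 0 ∧ 0 < b)) :
    HasConstantTermAt (fun s => w * s ^ ((a : ℚ) : ℝ) * Real.log s ^ b) 0 :=
  ⟨1, ![a], ![b], ![w], fun i => by simpa using hab, by simp⟩

/-- `HasConstantTermAt I c` depends only on the germ of `I` at `0⁺`. [folklore] -/
theorem congr (h : HasConstantTermAt I c) (hIJ : I =ᶠ[𝓝[>] 0] J) : HasConstantTermAt J c := by
  obtain ⟨k, a, b, w, hab, h⟩ := h
  exact ⟨k, a, b, w, hab, h.congr' (hIJ.mono fun s hs => by rw [hs])⟩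

/-- Constant terms add. [folklore] -/
theorem add (hI : HasConstantTermAt I c) (hJ : HasConstantTermAt J d) :
    HasConstantTermAt (I + J) (c + d) := by
  obtain ⟨k₁, a₁, b₁, w₁, hab₁, h₁⟩ := hI
  obtain ⟨k₂, a₂, b₂, w₂, hab₂, h₂⟩ := hJ
  refine of_fintype (Sum.elim a₁ a₂) (Sum.elim b₁ b₂) (Sum.elim w₁ w₂) ?_ ?_
  · rintro (i | j)
    exacts [hab₁ i, hab₂ j]
  · refine (h₁.add h₂).congr fun s => ?_
    simp only [Fintype.sum_sum_type, Sum.elim_inl, Sum.elim_inr, Pi.add_apply]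
    ring

/-- Constant terms are homogeneous. [folklore] -/
theorem const_mul (r : ℝ) (h : HasConstantTermAt I c) :
    HasConstantTermAt (fun s => r * I s) (r * c) := by
  obtain ⟨k, a, b, w, hab, h⟩ := h
  refine ⟨k, a, b, fun i => r * w i, hab, (h.const_mul r).congr fun s => ?_⟩
  rw [mul_sub, Finset.mul_sum]
  congr 1
  exact Finset.sum_congr rfl fun i _ => by ring

/-- Constant term of the negative. [folklore] -/
theorem neg (h : HasConstantTermAt I c) : HasConstantTermAt (-I) (-c) := by
  have := h.const_mul (-1)
  simp only [neg_mul, one_mul] at this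
  exact this

/-- Constant terms subtract. [folklore] -/
theorem sub (hI : HasConstantTermAt I c) (hJ : HasConstantTermAt J d) :
    HasConstantTermAt (I - J) (c - d) := by
  simpa [sub_eq_add_neg] using hI.add hJ.neg

/-- **Uniqueness of the constant term**: two divergent-monomial expansions of the same function
at `0⁺` have the same constant term (`eq_zero_of_tendsto_sum_divergentMonomials` applied to the
difference of the two expansions; cf. Kaiser 2017, Prop. 4.7 for the Puiseux-series mirror).
[folklore] -/
theorem unique (hc : HasConstantTermAt I c) (hd : HasConstantTermAt I d) : c = d := by
  obtain ⟨k₁, a₁, b₁, w₁, hab₁, h₁⟩ := hc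
  obtain ⟨k₂, a₂, b₂, w₂, hab₂, h₂⟩ := hd
  -- the difference of the two expansions is ONE finite combination of divergent monomials
  let A : Fin k₁ ⊕ Fin k₂ → ℝ := Sum.elim (fun i => ((a₁ i : ℚ) : ℝ)) fun j => ((a₂ j : ℚ) : ℝ)
  let B : Fin k₁ ⊕ Fin k₂ → ℕ := Sum.elim b₁ b₂
  let W : Fin k₁ ⊕ Fin k₂ → ℝ := Sum.elim (fun i => -w₁ i) w₂
  have hdiv : ∀ i ∈ (Finset.univ : Finset (Fin k₁ ⊕ Fin k₂)), A i < 0 ∨ (A i = 0 ∧ 0 < B i) := by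
    rintro (i | j) -
    · simp only [A, B, Sum.elim_inl]
      exact_mod_cast hab₁ i
    · simp only [A, B, Sum.elim_inr]
      exact_mod_cast hab₂ j
  have key : Tendsto (fun s : ℝ => ∑ i, W i * s ^ (A i) * Real.log s ^ (B i)) (𝓝[>] 0)
      (𝓝 (c - d)) := by
    refine (h₁.sub h₂).congr fun s => ?_
    simp only [A, B, W, Fintype.sum_sum_type, Sum.elim_inl, Sum.elim_inr, neg_mul,
      Finset.sum_neg_distrib]
    ring
  have := Literature.Analysis.Asymptotics.eq_zero_of_tendsto_sum_divergentMonomials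
    Finset.univ hdiv key
  linarith

/-- A function with a finite limit at `0⁺` has that limit as its only constant term. [folklore] -/
theorem eq_of_tendsto (h : HasConstantTermAt I c) (hd : Tendsto I (𝓝[>] 0) (𝓝 d)) : c = d :=
  h.unique (of_tendsto hd)

end HasConstantTermAt

/-! ### Slices of an integral representation over the first coordinate -/

/-- The **slice value** of an `(n+1)`-dimensional integral representation `R` over the parameter
coordinate `z 0 = s`: the `n`-dimensional integral
`∫ x in {x | vecCons s x ∈ R.domain}, R.integrand (vecCons s x)` — `R` read as a family of
`n`-dimensional integrals parametrised by `s` (by Fubini `∫ s, sliceValue R s = R.value`, file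
`KZSliceFubini`). Verbatim the slice integral inlined in the route `ValuedFieldSpecialisation`
(summit `KontsevichZagierPeriods`). [cite: KontsevichZagier2001, §1.2] -/
def sliceValue (R : IntegralRep (n + 1)) (s : ℝ) : ℝ :=
  ∫ x in {x : Fin n → ℝ | Matrix.vecCons s x ∈ R.domain}, R.integrand (Matrix.vecCons s x)

/-- Unfolding of `sliceValue`. [cite: KontsevichZagier2001, §1.2] -/
theorem sliceValue_def (R : IntegralRep (n + 1)) (s : ℝ) :
    sliceValue R s =
      ∫ x in {x : Fin n → ℝ | Matrix.vecCons s x ∈ R.domain}, R.integrand (Matrix.vecCons s x) :=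
  rfl

/-- `HasConstantTerm R c`: `c` is the **constant term** of a finite divergent-monomial expansion
of the slice values of `R` as `s → 0⁺`,
`sliceValue R s = ∑ i, w i * s ^ (a i) * (log s) ^ (b i) + c + o(1)` with
`a i < 0 ∨ (a i = 0 ∧ 0 < b i)`, `a i ∈ ℚ` (`HasConstantTermAt (sliceValue R) c`). EXACTLY the
clause inlined in the route `ValuedFieldSpecialisation` (summit `KontsevichZagierPeriods`, items
`CTConstruction` (CT1), `ConstantTermsArePeriods`, `ConstantTermUnique`): `hasConstantTerm_iff` is
`Iff.rfl`. For every `ℚ`-semialgebraic `R` such an expansion exists (Comte–Lion–Rolin 2000,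
Thm. 1; Cluckers–Miller 2011, Thm. 1.3) — not part of this definition (cf. Kaiser 2017, Def. 4.4
for the Puiseux-series mirror of such expansions). [folklore] -/
def HasConstantTerm (R : IntegralRep (n + 1)) (c : ℝ) : Prop :=
  HasConstantTermAt (sliceValue R) c

/-- `HasConstantTerm R c` unfolds DEFINITIONALLY to the clause inlined in the route
`ValuedFieldSpecialisation` (items `CTConstruction`, `ConstantTermsArePeriods`,
`ConstantTermUnique`). [folklore] -/
theorem hasConstantTerm_iff (R : IntegralRep (n + 1)) (c : ℝ) :
    HasConstantTerm R c ↔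
      ∃ (k : ℕ) (a : Fin k → ℚ) (b : Fin k → ℕ) (w : Fin k → ℝ),
        (∀ i, a i < 0 ∨ (a i = 0 ∧ 0 < b i)) ∧
          Filter.Tendsto (fun s : ℝ =>
            (∫ x in {x : Fin n → ℝ | Matrix.vecCons s x ∈ R.domain},
                R.integrand (Matrix.vecCons s x)) -
              ∑ i, w i * s ^ ((a i : ℚ) : ℝ) * Real.log s ^ (b i))
            (nhdsWithin 0 (Set.Ioi 0)) (nhds c) :=
  Iff.rfl

namespace HasConstantTerm

variable {R R' R₁ R₂ : IntegralRep (n + 1)} {c c' c₁ c₂ : ℝ}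

/-- **Uniqueness of the constant term** of the slice expansion (route support item
`ConstantTermUnique`; cf. Kaiser 2017, Prop. 4.7). [folklore] -/
theorem unique (h₁ : HasConstantTerm R c₁) (h₂ : HasConstantTerm R c₂) : c₁ = c₂ :=
  HasConstantTermAt.unique h₁ h₂

/-- A family whose slice values converge to `c` as `s → 0⁺` has constant term `c`, with no
divergent monomials (consistency of (CT3) with (CT1) in the route). [folklore] -/
theorem of_tendsto (h : Tendsto (sliceValue R) (𝓝[>] 0) (𝓝 c)) : HasConstantTerm R c :=
  HasConstantTermAt.of_tendsto h

/-- If the slice values converge to `c'` as `s → 0⁺`, then `c'` is the only constant term.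
[folklore] -/
theorem eq_of_tendsto (h : HasConstantTerm R c) (h' : Tendsto (sliceValue R) (𝓝[>] 0) (𝓝 c')) :
    c = c' :=
  HasConstantTermAt.eq_of_tendsto h h'

/-- The constant term only depends on the slice values for all sufficiently small `s > 0`
(invariance under any modification of `R` not affecting the germ of `sliceValue R` at `0⁺`).
[folklore] -/
theorem congr (h : HasConstantTerm R c)
    (hRR' : ∀ᶠ s in 𝓝[>] (0 : ℝ), sliceValue R s = sliceValue R' s) : HasConstantTerm R' c :=
  HasConstantTermAt.congr h hRR'

/-- **Additivity of constant terms**: if for all sufficiently small `s > 0` the slice value of `R`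
is the sum of those of `R₁` and `R₂`, constant terms add. Almost-everywhere-in-`s` additivity is
NOT enough (`Tendsto` along `𝓝[>] 0` uses every small `s`). [folklore] -/
theorem add_of_eventuallyEq (h₁ : HasConstantTerm R₁ c₁) (h₂ : HasConstantTerm R₂ c₂)
    (hadd : ∀ᶠ s in 𝓝[>] (0 : ℝ), sliceValue R s = sliceValue R₁ s + sliceValue R₂ s) :
    HasConstantTerm R (c₁ + c₂) :=
  HasConstantTermAt.congr (HasConstantTermAt.add h₁ h₂) (hadd.mono fun _ hs => hs.symm)

end HasConstantTerm

/-- The slice values of the negative representation `R.neg`. [cite: KontsevichZagier2001, §1.1] -/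
@[simp] theorem sliceValue_neg (R : IntegralRep (n + 1)) (s : ℝ) :
    sliceValue R.neg s = -sliceValue R s := by
  simp [sliceValue, integral_neg]

/-- Constant term of the negative representation. [folklore] -/
theorem HasConstantTerm.neg {R : IntegralRep (n + 1)} {c : ℝ} (h : HasConstantTerm R c) :
    HasConstantTerm R.neg (-c) :=
  HasConstantTermAt.congr (HasConstantTermAt.neg h) (Eventually.of_forall fun _ => by simp)

/-! ### Slice values: Fubini and additivity (from `KZSliceFubini`) -/

/-- **Fubini over the parameter coordinate**: `∫ s, sliceValue R s = R.value`.
[cite: KontsevichZagier2001, §1.2] -/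
theorem integral_sliceValue (R : IntegralRep (n + 1)) : ∫ s, sliceValue R s = R.value :=
  integral_integral_slice R

/-- `sliceValue R` is an integrable function of the parameter. [cite: KontsevichZagier2001, §1.2] -/
theorem integrable_sliceValue (R : IntegralRep (n + 1)) : Integrable (sliceValue R) :=
  integrable_integral_slice R

/-- **Slices of integrand additivity** (data of `KZ.integrandAddRel`): at every `s` at which the
slices of `R₁`, `R₂` are absolutely integrable, `sliceValue R s = sliceValue R₁ s + sliceValue R₂ s`.
[cite: KontsevichZagier2001, §1.2 rule (1)] -/
theorem sliceValue_add_of_integrand {R R₁ R₂ : IntegralRep (n + 1)}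
    (h₁ : R₁.domain = R.domain) (h₂ : R₂.domain = R.domain)
    (hadd : EqOn R.integrand (R₁.integrand + R₂.integrand) R.domain) {s : ℝ}
    (hi₁ : IntegrableOn (fun x => R₁.integrand (Matrix.vecCons s x))
      {x : Fin n → ℝ | Matrix.vecCons s x ∈ R₁.domain})
    (hi₂ : IntegrableOn (fun x => R₂.integrand (Matrix.vecCons s x))
      {x : Fin n → ℝ | Matrix.vecCons s x ∈ R₂.domain}) :
    sliceValue R s = sliceValue R₁ s + sliceValue R₂ s :=
  integral_slice_add_of_integrand h₁ h₂ hadd hi₁ hi₂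

/-- **Slices of domain additivity** (data of `KZ.domainAddRel`): at every `s` at which the slices
of `R₁.domain`, `R₂.domain` meet in a null set and the slice of `R` is absolutely integrable,
`sliceValue R s = sliceValue R₁ s + sliceValue R₂ s`. [cite: KontsevichZagier2001, §1.2 rule (1)] -/
theorem sliceValue_add_of_domain {R R₁ R₂ : IntegralRep (n + 1)}
    (hdom : R.domain = R₁.domain ∪ R₂.domain) (h₁ : EqOn R.integrand R₁.integrand R₁.domain)
    (h₂ : EqOn R.integrand R₂.integrand R₂.domain) {s : ℝ}
    (hnull : volume ({x : Fin n → ℝ | Matrix.vecCons s x ∈ R₁.domain} ∩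
      {x : Fin n → ℝ | Matrix.vecCons s x ∈ R₂.domain}) = 0)
    (hi : IntegrableOn (fun x => R.integrand (Matrix.vecCons s x))
      {x : Fin n → ℝ | Matrix.vecCons s x ∈ R.domain}) :
    sliceValue R s = sliceValue R₁ s + sliceValue R₂ s :=
  integral_slice_add_of_domain hdom h₁ h₂ hnull hi

/-- Under the integrand-additivity hypotheses on the total spaces, slice values add for almost
every `s` (NOT for every `s`; see `HasConstantTerm.add_of_eventuallyEq`).
[cite: KontsevichZagier2001, §1.2 rule (1)] -/
theorem ae_sliceValue_add_of_integrand {R R₁ R₂ : IntegralRep (n + 1)}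
    (h₁ : R₁.domain = R.domain) (h₂ : R₂.domain = R.domain)
    (hadd : EqOn R.integrand (R₁.integrand + R₂.integrand) R.domain) :
    ∀ᵐ s : ℝ, sliceValue R s = sliceValue R₁ s + sliceValue R₂ s :=
  ae_integral_slice_add_of_integrand h₁ h₂ hadd

/-- Under the domain-additivity hypotheses on the total spaces (`volume (R₁.domain ∩ R₂.domain) = 0`),
slice values add for almost every `s` (NOT for every `s`).
[cite: KontsevichZagier2001, §1.2 rule (1)] -/
theorem ae_sliceValue_add_of_domain {R R₁ R₂ : IntegralRep (n + 1)}
    (hdom : R.domain = R₁.domain ∪ R₂.domain) (hnull : volume (R₁.domain ∩ R₂.domain) = 0)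
    (h₁ : EqOn R.integrand R₁.integrand R₁.domain) (h₂ : EqOn R.integrand R₂.integrand R₂.domain) :
    ∀ᵐ s : ℝ, sliceValue R s = sliceValue R₁ s + sliceValue R₂ s :=
  ae_integral_slice_add_of_domain hdom hnull h₁ h₂

end KZ

end Literature.NumberTheory.Transcendental
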